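import Summits.KontsevichZagierPeriods.KontsevichZagierPeriods.Theorems.MzvKernelInKZ.Negative.DimFourDissection

/-!
# `MzvKernelInKZ` (stmt-KontsevichZagierPeriods-3914): negative side — the Calabi polytope `P₄` is the cell `U`, by two reflections

Companion of `Negative/DimFourDissection.lean`.  The Calabi polytope
`P₄ = {uᵢ + uᵢ₊₁ < π/2 (cyclically)}` in half-angle coordinates (`P4set`,
`cz z i j : zᵢ + zⱼ + zᵢzⱼ < 1`) is carried onto the base cell `U = {z₀, z₂ < z₁, z₃}` by reflecting
the coordinates `1` and `3` (`refl4`, `uᵢ ↦ π/2 − uᵢ`), ONE change-of-variables move under which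
`g⊗4` is invariant (`P4rep_sub_Urep_mem_cov`); hence **`[Q⁴] − 6 • [P₄, g⊗4] ∈ KZ.relations`**
(`of_G4_sub_six_P4rep_mem`: `vol P₄ = (π/2)⁴/6`, Beukers–Kolk–Calabi's combinatorial volume, here
as a scissors congruence).

Sources: F. Beukers, J. A. C. Kolk, E. Calabi, *Sums of generalized harmonic series and volumes*, Nieuw Arch. Wisk. (4) 11 (1993), 217–224; M. Kontsevich, D. Zagier, *Periods* (2001), §1.2.
-/

noncomputable section

namespace Summit.KontsevichZagierPeriods.MzvKernelInKZ.Negative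

open Set MeasureTheory MvPolynomial
open Literature.NumberTheory.Transcendental
open Literature.ModelTheory.ExponentialFields (IsSemialgebraic)

/-- The polytope condition `uᵢ + uⱼ < π/2` in half-angle coordinates. [folklore] -/
def cz (z : Fin 4 → ℝ) (i j : Fin 4) : Prop := z i + z j + z i * z j < 1

/-- The Calabi polytope `P₄`. [folklore] -/
def P4set : Set (Fin 4 → ℝ) := G4.domain ∩ {z | cz z 0 1 ∧ cz z 1 2 ∧ cz z 2 3 ∧ cz z 3 0}

/-- `cz` is `ℚ`-semialgebraic. [folklore] -/
theorem isSemialgebraic_cz (i j : Fin 4) : IsSemialgebraic ℚ {z : Fin 4 → ℝ | cz z i j} := by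
  convert Literature.ModelTheory.ExponentialFields.isSemialgebraic_setOf_eval_pos (R := ℝ)
    (1 - (X i + X j + X i * X j) : MvPolynomial (Fin 4) ℚ) using 1
  ext z; simp [cz, sub_pos]

/-- `P4set` is `ℚ`-semialgebraic. [folklore] -/
theorem sa_P4set : IsSemialgebraic ℚ P4set := by
  refine G4.isSemialgebraic_domain.inter ?_
  have : {z : Fin 4 → ℝ | cz z 0 1 ∧ cz z 1 2 ∧ cz z 2 3 ∧ cz z 3 0} =
      {z | cz z 0 1} ∩ {z | cz z 1 2} ∩ {z | cz z 2 3} ∩ {z | cz z 3 0} := by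
    ext z; simp [and_assoc]
  rw [this]
  exact (((isSemialgebraic_cz _ _).inter (isSemialgebraic_cz _ _)).inter (isSemialgebraic_cz _ _)).inter
    (isSemialgebraic_cz _ _)

/-- `[P₄, g⊗g⊗g⊗g]`. [folklore] -/
def P4rep : KZ.IntegralRep 4 := G4.restrict P4set sa_P4set inter_subset_left

/-- Membership in `P4set`, unfolded. [folklore] -/
theorem mem_P4set {z : Fin 4 → ℝ} :
    z ∈ P4set ↔ (∀ i, 0 < z i ∧ z i < 1) ∧ cz z 0 1 ∧ cz z 1 2 ∧ cz z 2 3 ∧ cz z 3 0 := by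
  rw [P4set, mem_inter_iff, mem_G4_domain]; rfl

/-- `uᵢ + uⱼ < π/2 ↔ tᵢ < ρ tⱼ` in the half-angle parameter. [folklore] -/
theorem cz_iff_lt_rho {a b : ℝ} (hb : -1 < b) : a + b + a * b < 1 ↔ a < rho b := by
  rw [rho, lt_div_iff₀ (by linarith)]
  constructor <;> intro h <;> nlinarith

/-- The double reflection on coordinates `1` and `3`. [folklore] -/
def refl4 (z : Fin 4 → ℝ) : Fin 4 → ℝ := ![z 0, rho (z 1), z 2, rho (z 3)]

/-- Component `0` of the double reflection. [folklore] -/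
@[simp] theorem refl4_0 (z : Fin 4 → ℝ) : refl4 z 0 = z 0 := rfl
/-- Component `1` of the double reflection. [folklore] -/
@[simp] theorem refl4_1 (z : Fin 4 → ℝ) : refl4 z 1 = rho (z 1) := rfl
/-- Component `2` of the double reflection. [folklore] -/
@[simp] theorem refl4_2 (z : Fin 4 → ℝ) : refl4 z 2 = z 2 := rfl
/-- Component `3` of the double reflection. [folklore] -/
@[simp] theorem refl4_3 (z : Fin 4 → ℝ) : refl4 z 3 = rho (z 3) := rfl

/-- Its derivative `diag(1, ρ'(z₁), 1, ρ'(z₃))`. [folklore] -/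
def refl4Deriv (z : Fin 4 → ℝ) : (Fin 4 → ℝ) →L[ℝ] (Fin 4 → ℝ) :=
  LinearMap.toContinuousLinearMap (Matrix.toLin'
    !![1, 0, 0, 0; 0, -2 / (1 + z 1) ^ 2, 0, 0; 0, 0, 1, 0; 0, 0, 0, -2 / (1 + z 3) ^ 2])

/-- The determinant of `refl4Deriv`. [folklore] -/
theorem det_refl4Deriv (z : Fin 4 → ℝ) : (refl4Deriv z).det = (-2 / (1 + z 1) ^ 2) * (-2 / (1 + z 3) ^ 2) := by
  have h : (!![1, 0, 0, 0; 0, -2 / (1 + z 1) ^ 2, 0, 0; 0, 0, 1, 0; 0, 0, 0, -2 / (1 + z 3) ^ 2] :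
      Matrix (Fin 4) (Fin 4) ℝ).det = (-2 / (1 + z 1) ^ 2) * (-2 / (1 + z 3) ^ 2) := by
    simp [Matrix.det_succ_row_zero, Fin.sum_univ_succ]
  rw [← h]; exact LinearMap.det_toLin' _

/-- Differentiability of `refl4` with the stated derivative. [folklore] -/
theorem hasFDerivAt_refl4 {z : Fin 4 → ℝ} (h1 : z 1 ≠ -1) (h3 : z 3 ≠ -1) : HasFDerivAt refl4 (refl4Deriv z) z := by
  have p : ∀ i : Fin 4, HasFDerivAt (fun y : Fin 4 → ℝ => y i)
      (ContinuousLinearMap.proj (R := ℝ) (φ := fun _ : Fin 4 => ℝ) i) z := fun i => hasFDerivAt_apply i z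
  have r1 := (hasDerivAt_rho h1).comp_hasFDerivAt z (p 1)
  have r3 := (hasDerivAt_rho h3).comp_hasFDerivAt z (p 3)
  have c0 : HasFDerivAt (fun y : Fin 4 → ℝ => refl4 y 0) ((ContinuousLinearMap.proj 0).comp (refl4Deriv z)) z := by
    refine (p 0).congr_fderiv ?_; ext v; simp [refl4Deriv, dotProduct, Fin.sum_univ_four]
  have c1 : HasFDerivAt (fun y : Fin 4 → ℝ => refl4 y 1) ((ContinuousLinearMap.proj 1).comp (refl4Deriv z)) z := by
    refine r1.congr_fderiv ?_; ext v; simp [refl4Deriv, dotProduct, Fin.sum_univ_four]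
  have c2 : HasFDerivAt (fun y : Fin 4 → ℝ => refl4 y 2) ((ContinuousLinearMap.proj 2).comp (refl4Deriv z)) z := by
    refine (p 2).congr_fderiv ?_; ext v; simp [refl4Deriv, dotProduct, Fin.sum_univ_four]
  have c3 : HasFDerivAt (fun y : Fin 4 → ℝ => refl4 y 3) ((ContinuousLinearMap.proj 3).comp (refl4Deriv z)) z := by
    refine r3.congr_fderiv ?_; ext v; simp [refl4Deriv, dotProduct, Fin.sum_univ_four]
  rw [hasFDerivAt_pi']
  intro i; fin_cases i
  · exact c0
  · exact c1
  · exact c2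
  · exact c3

/-- Membership in the base cell `U`, unfolded. [folklore] -/
theorem mem_U {z : Fin 4 → ℝ} :
    z ∈ bp 0 2 1 3 ↔ (∀ i, 0 < z i ∧ z i < 1) ∧ z 0 < z 1 ∧ z 0 < z 3 ∧ z 2 < z 1 ∧ z 2 < z 3 := by
  rw [mem_bp, mem_G4_domain]

/-- Auxiliary lemma `refl4_mem_U` (see the module docstring). [folklore] -/
theorem refl4_mem_U {z : Fin 4 → ℝ} (hz : z ∈ P4set) : refl4 z ∈ bp 0 2 1 3 := by
  obtain ⟨hb, c01, c12, c23, c30⟩ := mem_P4set.mp hz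
  have m1 := rho_mem_Ioo (hb 1); have m3 := rho_mem_Ioo (hb 3)
  rw [mem_U]
  refine ⟨fun i => ?_, ?_, ?_, ?_, ?_⟩
  · fin_cases i
    · simpa using hb 0
    · simpa using m1
    · simpa using hb 2
    · simpa using m3
  · simpa using (cz_iff_lt_rho (by linarith [(hb 1).1])).mp c01
  · have : z 0 + z 3 + z 0 * z 3 < 1 := by unfold cz at c30; linarith
    simpa using (cz_iff_lt_rho (by linarith [(hb 3).1])).mp this
  · have : z 2 + z 1 + z 2 * z 1 < 1 := by unfold cz at c12; linarith
    simpa using (cz_iff_lt_rho (by linarith [(hb 1).1])).mp this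
  · simpa using (cz_iff_lt_rho (by linarith [(hb 3).1])).mp c23

/-- `refl4` is injective on its domain. [folklore] -/
theorem injOn_refl4 : InjOn refl4 P4set := by
  intro z hz z' hz' h
  obtain ⟨hb, -⟩ := mem_P4set.mp hz
  obtain ⟨hb', -⟩ := mem_P4set.mp hz'
  have e0 : z 0 = z' 0 := by simpa using congrFun h 0
  have e2 : z 2 = z' 2 := by simpa using congrFun h 2
  have e1 : z 1 = z' 1 := by
    have := congrArg rho (by simpa using congrFun h 1 : rho (z 1) = rho (z' 1))
    rwa [rho_rho (by linarith [(hb 1).1]), rho_rho (by linarith [(hb' 1).1])] at this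
  have e3 : z 3 = z' 3 := by
    have := congrArg rho (by simpa using congrFun h 3 : rho (z 3) = rho (z' 3))
    rwa [rho_rho (by linarith [(hb 3).1]), rho_rho (by linarith [(hb' 3).1])] at this
  funext i; fin_cases i <;> assumption

/-- The image of the domain under `refl4`. [folklore] -/
theorem image_refl4 : refl4 '' P4set = bp 0 2 1 3 := by
  apply Subset.antisymm
  · rintro _ ⟨z, hz, rfl⟩; exact refl4_mem_U hz
  · intro w hw
    obtain ⟨hb, c01, c03, c21, c23⟩ := mem_U.mp hw
    have m1 := rho_mem_Ioo (hb 1); have m3 := rho_mem_Ioo (hb 3)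
    have r1 : rho (rho (w 1)) = w 1 := rho_rho (by linarith [(hb 1).1])
    have r3 : rho (rho (w 3)) = w 3 := rho_rho (by linarith [(hb 3).1])
    refine ⟨![w 0, rho (w 1), w 2, rho (w 3)], ?_, ?_⟩
    · rw [mem_P4set]
      simp only [cz, Matrix.cons_val_zero, Matrix.cons_val_one, Matrix.cons_val]
      refine ⟨fun i => ?_, ?_, ?_, ?_, ?_⟩
      · fin_cases i
        · simpa using hb 0
        · simpa using m1
        · simpa using hb 2
        · simpa using m3
      · exact (cz_iff_lt_rho (by linarith [m1.1])).mpr (by rw [r1]; exact c01)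
      · have := (cz_iff_lt_rho (b := rho (w 1)) (a := w 2) (by linarith [m1.1])).mpr (by rw [r1]; exact c21)
        linarith
      · exact (cz_iff_lt_rho (by linarith [m3.1])).mpr (by rw [r3]; exact c23)
      · have := (cz_iff_lt_rho (b := rho (w 3)) (a := w 0) (by linarith [m3.1])).mpr (by rw [r3]; exact c03)
        linarith
    · funext i; fin_cases i
      · simp [refl4]
      · simp [refl4, r1]
      · simp [refl4]
      · simp [refl4, r3]

/-- `refl4` is a `ℚ`-semialgebraic map on its domain (rational or polynomial components). [folklore] -/
theorem isSemialgebraicMapOn_refl4 : IsSemialgebraicMapOn ℚ P4set refl4 := by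
  refine IsSemialgebraicMapOn.of_forall sa_P4set fun j => ?_
  have hr : ∀ i : Fin 4, IsSemialgebraicFunOn ℚ P4set fun z => rho (z i) := fun i => by
    refine (isSemialgebraicFunOn_aeval_div_aeval sa_P4set (1 - X i : MvPolynomial (Fin 4) ℚ) (1 + X i)
      fun z hz => ?_).congr fun z _ => ?_
    · obtain ⟨hb, -⟩ := mem_P4set.mp hz
      simp only [map_add, map_one, aeval_X]; linarith [(hb i).1]
    · simp [rho]
  fin_cases j
  · simpa [refl4] using isSemialgebraicFunOn_aeval sa_P4set (X 0)
  · simpa [refl4] using hr 1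
  · simpa [refl4] using isSemialgebraicFunOn_aeval sa_P4set (X 2)
  · simpa [refl4] using hr 3

/-- **`[P₄, g⊗4] − [U, g⊗4]` is ONE change of variables** (two reflections `uᵢ ↦ π/2 − uᵢ`). [folklore] -/
theorem P4rep_sub_Urep_mem_cov : KZ.of P4rep - KZ.of Urep ∈ KZ.changeOfVariablesRel := by
  refine ⟨4, P4rep, Urep, refl4, fun z => refl4Deriv z, isSemialgebraicMapOn_refl4, fun z hz => ?_, injOn_refl4,
    image_refl4.symm, fun z hz => ?_, rfl⟩
  · obtain ⟨hb, -⟩ := mem_P4set.mp hz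
    exact (hasFDerivAt_refl4 (by linarith [(hb 1).1]) (by linarith [(hb 3).1])).hasFDerivWithinAt
  · obtain ⟨hb, -⟩ := mem_P4set.mp hz
    have n1 : (1 : ℝ) + z 1 ≠ 0 := by linarith [(hb 1).1]
    have n3 : (1 : ℝ) + z 3 ≠ 0 := by linarith [(hb 3).1]
    change G4.integrand z = G4.integrand (refl4 z) * |(refl4Deriv z).det|
    rw [det_refl4Deriv, G4_integrand_apply, G4_integrand_apply]
    simp only [refl4_0, refl4_1, refl4_2, refl4_3]
    have hpos : 0 < (-2 / (1 + z 1) ^ 2) * (-2 / (1 + z 3) ^ 2) := by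
      have a : -2 / (1 + z 1) ^ 2 < 0 := div_neg_of_neg_of_pos (by norm_num) (by positivity)
      have b : -2 / (1 + z 3) ^ 2 < 0 := div_neg_of_neg_of_pos (by norm_num) (by positivity)
      exact mul_pos_of_neg_of_neg a b
    rw [abs_of_pos hpos, ← gq_rho_mul (show z 1 ≠ -1 by linarith [(hb 1).1]),
      ← gq_rho_mul (show z 3 ≠ -1 by linarith [(hb 3).1])]
    ring

/-- Hence **`Q⁴ ≡ 6·[P₄, g⊗4]`**. [folklore] -/
theorem of_G4_sub_six_P4rep_mem : KZ.of G4 - 6 • KZ.of P4rep ∈ KZ.relations := by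
  have h1 := of_G4_sub_six_Urep_mem
  have h2 := KZ.changeOfVariablesRel_subset_relations P4rep_sub_Urep_mem_cov
  have : KZ.of G4 - 6 • KZ.of P4rep = (KZ.of G4 - 6 • KZ.of Urep) - 6 • (KZ.of P4rep - KZ.of Urep) := by abel
  rw [this]
  exact sub_mem h1 (KZ.relations.nsmul_mem h2 6)

end Summit.KontsevichZagierPeriods.MzvKernelInKZ.Negative
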